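import Summits.CriticalPhenomena.Ising3DConformalLimit.Theorems.GapForcesFarMerging.Negative.TransparentPassage
import Summits.CriticalPhenomena.Ising3DConformalLimit.Theorems.GapForcesFarMerging.Negative.ScaleIterationDyadic

/-!
# `GapForcesFarMerging` (stmt-CriticalPhenomena-4468): item-ready promotion certificates

Route decl `Summit.CriticalPhenomena.Ising3DConformalLimit.Theses.EnergyNotSigmaSquared.GapForcesFarMerging`
(`= EnergyGapPowerLaw → FarMergingShape cc2 (criticalCorr 3 4)`, `Negative.SoftShapes.crux_iff`).

Purpose (lead seat c4, the seventh lead of this crux). Six leads and five planned lines have reduced the crux to ONE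
analytic core — one-passage quasi-multiplicativity / separation for pairs of SOURCED critical double currents on `ℤ³`
— in four currencies (QM / PT: line `rp-unpinch-single-passage`; `Floors ∧ HazardRelocation ∧ Unpin` and
`B ∧ H ∧ NS-osc ∧ M ∧ O`: line `screening-form-lemma-a1`; `AD ∧ MD′ (+ items 6150, 0636)`: line
`one-cluster-depletion-sandwich`), each with a kernel certificate "core ⇒ crux". For the planners to PROMOTE the core to a
statement item its text must elaborate STANDALONE over `Literature` vocabulary (no `Theorems`-level abbreviation such as
`up`, `dn`, `src`, `avoidS`, `cc2`, and no `def : Prop` of ours). This file states the three candidate promoted statements in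
that fully explicit form — INLINE, as hypotheses, nothing is defined — and proves for each that it implies the crux BY NAME,
so that an item filed with exactly this text closes 4468 by a one-line proof importing this module.

Notation in the comments: `e₂ = Pi.single 1 1`, `up m = (2m,m,0) = Pi.single 0 (2m) + Pi.single 1 m`,
`dn m = (2m,-m,0)`, `src s = s·e₂ = Pi.single 1 s`, and the single-pinch AVOIDANCE FUNCTIONAL
`𝒜(b;m) = (⟨σ₀σ_bσ_{up m}σ_{dn m}⟩ - ⟨σ₀σ_b⟩⟨σ_{up m}σ_{dn m}⟩)/(⟨σ₀σ_{dn m}⟩⟨σ_bσ_{up m}⟩)` (`= avoidS cc2 (criticalCorr 3 4) b m`;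
by the energy factorisation the normalised two-current avoidance of the strands `0 → dn m`, `b → up m`, a priori in `[0,2]`).

* (QM) `∃ c > 0, ∀ 1 ≤ s, 2s ≤ m: c·𝒜(e₂;s)·𝒜(src s;m) ≤ 𝒜(e₂;m)` — uniform one-passage quasi-multiplicativity
  (`= QuasiMultiplicativeShape cc2 (criticalCorr 3 4)` verbatim, `qmExplicit_iff`; numerically `Q = 𝒜(e₂;m)/(𝒜(e₂;s)𝒜(se₂;m))`
  `≈ 1.9–2.2`, flat in `m`, 3D Swendsen–Wang `L = 32`, kit j010495 (drefute g2); exact 2D Kac–Ward shadow `inf Q = 7.95`)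
  ⇒ crux: `gapForcesFarMerging_of_qmExplicit` (through the landed p76719 `gapForcesFarMerging_of_quasiMultiplicative`);
* (QM-dyadic) its sub-exponential-defect dyadic weakening (pairs `(2^i, 2^(i+ℓ))`, constant `≥ η^ℓ`, every `η < 1`, all large
  `ℓ`, finitely many exceptional `i`; `= QuasiMultiplicativeDyadicShape cc2 (criticalCorr 3 4)`, `qmDyadicExplicit_iff`)
  ⇒ crux: `gapForcesFarMerging_of_qmDyadicExplicit`;
* (PT) PINCHED TRANSPARENCY — dyadic QM demanded only across octave blocks whose OPENED strands do not merge
  (`U₄(0, dn, src 2^i, up) > -½⟨σ₀σ_dn⟩⟨σ_src σ_up⟩`), the exact consumption of the scale iteration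
  (`= PinchedTransparencyShape cc2 (criticalCorr 3 4)`, `ptExplicit_iff`) ⇒ crux: `gapForcesFarMerging_of_ptExplicit`
  (through `Negative.TransparentPassage.gapForcesFarMerging_of_transparency`).

Logical order, proved here from landed theorems: QM → QM-dyadic → PT → crux (`promotion_ladder`). Status (Disproof.lean v13
§7/§9/§10; `Negative/LineVerdicts`, `Negative/FarMergingWithoutQM`, `Negative/TransparentPassage`; seat c3's
`Cruxes/GapForcesFarMerging/BARRIER-rp-gff.md`): none of the three is soft (`quasiMultiplicative_false_without_model`,
`quasiMultiplicativeDyadic_false_without_model`, `pinchedTransparency_false_without_model`), none is reachable by reflection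
positivity, QM is not necessary over the soft package (family E) while PT holds for family E; all three are statements about
`criticalCorr 3 2` / `criticalCorr 3 4` only. They are NOT literature facts (open; the recorded missing technology is a
separation + up-to-constants gluing lemma for sourced critical double currents on `ℤ³`).
-/

noncomputable section

namespace Summit.CriticalPhenomena.Ising3DConformalLimit.EnergyNotSigmaSquaredGapForcesFarMerging.Promotion

open Literature.Probability.LatticeModels
open Summit.CriticalPhenomena.Ising3DConformalLimit.Theses.EnergyNotSigmaSquared
open Summit.CriticalPhenomena.Ising3DConformalLimit.Theorems.GapForcesFarMerging.Negative
open Summit.CriticalPhenomena.Ising3DConformalLimit.EnergyNotSigmaSquaredGapForcesFarMerging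
  (gapForcesFarMerging_of_quasiMultiplicative gapForcesFarMerging_of_quasiMultiplicativeDyadic)

/-- The explicit QM text IS `QuasiMultiplicativeShape cc2 (criticalCorr 3 4)` (definitional unfolding of
`avoidS, TS, NparS, pairCovS, up, dn, xR, src, e₂, cc2`). [folklore] -/
theorem qmExplicit_iff :
    (∃ c : ℝ, 0 < c ∧ ∀ s m : ℕ, 1 ≤ s → 2 * s ≤ m →
      c * ((criticalCorr 3 4 ![0, Pi.single 1 1, Pi.single 0 (2 * (s : ℤ)) + Pi.single 1 (s : ℤ), Pi.single 0 (2 * (s : ℤ)) - Pi.single 1 (s : ℤ)] - criticalCorr 3 2 ![0, Pi.single 1 1] * criticalCorr 3 2 ![Pi.single 0 (2 * (s : ℤ)) + Pi.single 1 (s : ℤ), Pi.single 0 (2 * (s : ℤ)) - Pi.single 1 (s : ℤ)]) / (criticalCorr 3 2 ![0, Pi.single 0 (2 * (s : ℤ)) - Pi.single 1 (s : ℤ)] * criticalCorr 3 2 ![Pi.single 1 1, Pi.single 0 (2 * (s : ℤ)) + Pi.single 1 (s : ℤ)])) *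
          ((criticalCorr 3 4 ![0, Pi.single 1 (s : ℤ), Pi.single 0 (2 * (m : ℤ)) + Pi.single 1 (m : ℤ), Pi.single 0 (2 * (m : ℤ)) - Pi.single 1 (m : ℤ)] - criticalCorr 3 2 ![0, Pi.single 1 (s : ℤ)] * criticalCorr 3 2 ![Pi.single 0 (2 * (m : ℤ)) + Pi.single 1 (m : ℤ), Pi.single 0 (2 * (m : ℤ)) - Pi.single 1 (m : ℤ)]) / (criticalCorr 3 2 ![0, Pi.single 0 (2 * (m : ℤ)) - Pi.single 1 (m : ℤ)] * criticalCorr 3 2 ![Pi.single 1 (s : ℤ), Pi.single 0 (2 * (m : ℤ)) + Pi.single 1 (m : ℤ)])) ≤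
        ((criticalCorr 3 4 ![0, Pi.single 1 1, Pi.single 0 (2 * (m : ℤ)) + Pi.single 1 (m : ℤ), Pi.single 0 (2 * (m : ℤ)) - Pi.single 1 (m : ℤ)] - criticalCorr 3 2 ![0, Pi.single 1 1] * criticalCorr 3 2 ![Pi.single 0 (2 * (m : ℤ)) + Pi.single 1 (m : ℤ), Pi.single 0 (2 * (m : ℤ)) - Pi.single 1 (m : ℤ)]) / (criticalCorr 3 2 ![0, Pi.single 0 (2 * (m : ℤ)) - Pi.single 1 (m : ℤ)] * criticalCorr 3 2 ![Pi.single 1 1, Pi.single 0 (2 * (m : ℤ)) + Pi.single 1 (m : ℤ)]))) ↔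
      QuasiMultiplicativeShape cc2 (criticalCorr 3 4) :=
  Iff.rfl

/-- **Certificate (QM)**: uniform one-passage quasi-multiplicativity of the single-pinch avoidance functional of the
critical correlators of `ℤ³`, in item-ready explicit form, closes the crux BY NAME (landed reduction p76719). [folklore] -/
theorem gapForcesFarMerging_of_qmExplicit :
    (∃ c : ℝ, 0 < c ∧ ∀ s m : ℕ, 1 ≤ s → 2 * s ≤ m →
      c * ((criticalCorr 3 4 ![0, Pi.single 1 1, Pi.single 0 (2 * (s : ℤ)) + Pi.single 1 (s : ℤ), Pi.single 0 (2 * (s : ℤ)) - Pi.single 1 (s : ℤ)] - criticalCorr 3 2 ![0, Pi.single 1 1] * criticalCorr 3 2 ![Pi.single 0 (2 * (s : ℤ)) + Pi.single 1 (s : ℤ), Pi.single 0 (2 * (s : ℤ)) - Pi.single 1 (s : ℤ)]) / (criticalCorr 3 2 ![0, Pi.single 0 (2 * (s : ℤ)) - Pi.single 1 (s : ℤ)] * criticalCorr 3 2 ![Pi.single 1 1, Pi.single 0 (2 * (s : ℤ)) + Pi.single 1 (s : ℤ)])) *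
          ((criticalCorr 3 4 ![0, Pi.single 1 (s : ℤ), Pi.single 0 (2 * (m : ℤ)) + Pi.single 1 (m : ℤ), Pi.single 0 (2 * (m : ℤ)) - Pi.single 1 (m : ℤ)] - criticalCorr 3 2 ![0, Pi.single 1 (s : ℤ)] * criticalCorr 3 2 ![Pi.single 0 (2 * (m : ℤ)) + Pi.single 1 (m : ℤ), Pi.single 0 (2 * (m : ℤ)) - Pi.single 1 (m : ℤ)]) / (criticalCorr 3 2 ![0, Pi.single 0 (2 * (m : ℤ)) - Pi.single 1 (m : ℤ)] * criticalCorr 3 2 ![Pi.single 1 (s : ℤ), Pi.single 0 (2 * (m : ℤ)) + Pi.single 1 (m : ℤ)])) ≤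
        ((criticalCorr 3 4 ![0, Pi.single 1 1, Pi.single 0 (2 * (m : ℤ)) + Pi.single 1 (m : ℤ), Pi.single 0 (2 * (m : ℤ)) - Pi.single 1 (m : ℤ)] - criticalCorr 3 2 ![0, Pi.single 1 1] * criticalCorr 3 2 ![Pi.single 0 (2 * (m : ℤ)) + Pi.single 1 (m : ℤ), Pi.single 0 (2 * (m : ℤ)) - Pi.single 1 (m : ℤ)]) / (criticalCorr 3 2 ![0, Pi.single 0 (2 * (m : ℤ)) - Pi.single 1 (m : ℤ)] * criticalCorr 3 2 ![Pi.single 1 1, Pi.single 0 (2 * (m : ℤ)) + Pi.single 1 (m : ℤ)]))) →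
      GapForcesFarMerging :=
  fun h => gapForcesFarMerging_of_quasiMultiplicative (qmExplicit_iff.mp h)

/-- The explicit dyadic QM text IS `QuasiMultiplicativeDyadicShape cc2 (criticalCorr 3 4)`. [folklore] -/
theorem qmDyadicExplicit_iff :
    (∀ η : ℝ, 0 < η → η < 1 → ∃ ℓ₀ : ℕ, ∀ ℓ : ℕ, ℓ₀ ≤ ℓ → ∃ c : ℝ, η ^ ℓ ≤ c ∧ ∃ i₁ : ℕ, ∀ i : ℕ, i₁ ≤ i →
      c * ((criticalCorr 3 4 ![0, Pi.single 1 1, Pi.single 0 (2 * ((2 ^ i : ℕ) : ℤ)) + Pi.single 1 ((2 ^ i : ℕ) : ℤ), Pi.single 0 (2 * ((2 ^ i : ℕ) : ℤ)) - Pi.single 1 ((2 ^ i : ℕ) : ℤ)] - criticalCorr 3 2 ![0, Pi.single 1 1] * criticalCorr 3 2 ![Pi.single 0 (2 * ((2 ^ i : ℕ) : ℤ)) + Pi.single 1 ((2 ^ i : ℕ) : ℤ), Pi.single 0 (2 * ((2 ^ i : ℕ) : ℤ)) - Pi.single 1 ((2 ^ i : ℕ) : ℤ)]) / (criticalCorr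 3 2 ![0, Pi.single 0 (2 * ((2 ^ i : ℕ) : ℤ)) - Pi.single 1 ((2 ^ i : ℕ) : ℤ)] * criticalCorr 3 2 ![Pi.single 1 1, Pi.single 0 (2 * ((2 ^ i : ℕ) : ℤ)) + Pi.single 1 ((2 ^ i : ℕ) : ℤ)])) *
          ((criticalCorr 3 4 ![0, Pi.single 1 ((2 ^ i : ℕ) : ℤ), Pi.single 0 (2 * ((2 ^ (i + ℓ) : ℕ) : ℤ)) + Pi.single 1 ((2 ^ (i + ℓ) : ℕ) : ℤ), Pi.single 0 (2 * ((2 ^ (i + ℓ) : ℕ) : ℤ)) - Pi.single 1 ((2 ^ (i + ℓ) : ℕ) : ℤ)] - criticalCorr 3 2 ![0, Pi.single 1 ((2 ^ i : ℕ) : ℤ)] * criticalCorr 3 2 ![Pi.single 0 (2 * ((2 ^ (i + ℓ) : ℕ) : ℤ)) + Pi.single 1 ((2 ^ (i + ℓ) : ℕ) : ℤ), Pi.single 0 (2 * ((2 ^ (i + ℓ) : ℕ) : ℤ)) - Pi.single 1 ((2 ^ (i + ℓ) : ℕ) : ℤ)]) / (criticalCorr 3 2 ![0, Pi.single 0 (2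 * ((2 ^ (i + ℓ) : ℕ) : ℤ)) - Pi.single 1 ((2 ^ (i + ℓ) : ℕ) : ℤ)] * criticalCorr 3 2 ![Pi.single 1 ((2 ^ i : ℕ) : ℤ), Pi.single 0 (2 * ((2 ^ (i + ℓ) : ℕ) : ℤ)) + Pi.single 1 ((2 ^ (i + ℓ) : ℕ) : ℤ)])) ≤
        ((criticalCorr 3 4 ![0, Pi.single 1 1, Pi.single 0 (2 * ((2 ^ (i + ℓ) : ℕ) : ℤ)) + Pi.single 1 ((2 ^ (i + ℓ) : ℕ) : ℤ), Pi.single 0 (2 * ((2 ^ (i + ℓ) : ℕ) : ℤ)) - Pi.single 1 ((2 ^ (i + ℓ) : ℕ) : ℤ)] - criticalCorr 3 2 ![0, Pi.single 1 1] * criticalCorr 3 2 ![Pi.single 0 (2 * ((2 ^ (i + ℓ) : ℕ) : ℤ)) + Pi.single 1 ((2 ^ (i + ℓ) : ℕ) : ℤ), Pi.single 0 (2 * ((2 ^ (i + ℓ) : ℕ) : ℤ)) - Pi.single 1 ((2 ^ (i + ℓ) : ℕ) : ℤ)]) / (criticalCorr 3 2 ![0, Pi.single 0 (2 * ((2 ^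 (i + ℓ) : ℕ) : ℤ)) - Pi.single 1 ((2 ^ (i + ℓ) : ℕ) : ℤ)] * criticalCorr 3 2 ![Pi.single 1 1, Pi.single 0 (2 * ((2 ^ (i + ℓ) : ℕ) : ℤ)) + Pi.single 1 ((2 ^ (i + ℓ) : ℕ) : ℤ)]))) ↔
      QuasiMultiplicativeDyadicShape cc2 (criticalCorr 3 4) :=
  Iff.rfl

/-- **Certificate (QM-dyadic)**: the sub-exponential-defect dyadic quasi-multiplicativity, in item-ready explicit form,
closes the crux BY NAME (landed reduction p76719, dyadic form). [folklore] -/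
theorem gapForcesFarMerging_of_qmDyadicExplicit :
    (∀ η : ℝ, 0 < η → η < 1 → ∃ ℓ₀ : ℕ, ∀ ℓ : ℕ, ℓ₀ ≤ ℓ → ∃ c : ℝ, η ^ ℓ ≤ c ∧ ∃ i₁ : ℕ, ∀ i : ℕ, i₁ ≤ i →
      c * ((criticalCorr 3 4 ![0, Pi.single 1 1, Pi.single 0 (2 * ((2 ^ i : ℕ) : ℤ)) + Pi.single 1 ((2 ^ i : ℕ) : ℤ), Pi.single 0 (2 * ((2 ^ i : ℕ) : ℤ)) - Pi.single 1 ((2 ^ i : ℕ) : ℤ)] - criticalCorr 3 2 ![0, Pi.single 1 1] * criticalCorr 3 2 ![Pi.single 0 (2 * ((2 ^ i : ℕ) : ℤ)) + Pi.single 1 ((2 ^ i : ℕ) : ℤ), Pi.single 0 (2 * ((2 ^ i : ℕ) : ℤ)) - Pi.single 1 ((2 ^ i : ℕ) : ℤ)]) / (criticalCorr 3 2 ![0, Pi.single 0 (2 * ((2 ^ i : ℕ) : ℤ)) - Pi.single 1 ((2 ^ i : ℕ) : ℤ)] * criticalCorr 3 2 ![Pi.single 1 1, Pi.single 0 (2 *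 ((2 ^ i : ℕ) : ℤ)) + Pi.single 1 ((2 ^ i : ℕ) : ℤ)])) *
          ((criticalCorr 3 4 ![0, Pi.single 1 ((2 ^ i : ℕ) : ℤ), Pi.single 0 (2 * ((2 ^ (i + ℓ) : ℕ) : ℤ)) + Pi.single 1 ((2 ^ (i + ℓ) : ℕ) : ℤ), Pi.single 0 (2 * ((2 ^ (i + ℓ) : ℕ) : ℤ)) - Pi.single 1 ((2 ^ (i + ℓ) : ℕ) : ℤ)] - criticalCorr 3 2 ![0, Pi.single 1 ((2 ^ i : ℕ) : ℤ)] * criticalCorr 3 2 ![Pi.single 0 (2 * ((2 ^ (i + ℓ) : ℕ) : ℤ)) + Pi.single 1 ((2 ^ (i + ℓ) : ℕ) : ℤ), Pi.single 0 (2 * ((2 ^ (i + ℓ) : ℕ) : ℤ)) - Pi.single 1 ((2 ^ (i + ℓ) : ℕ) : ℤ)]) / (criticalCorr 3 2 ![0, Pi.single 0 (2 * ((2 ^ (i + ℓ) : ℕ) : ℤ)) - Pi.single 1 ((2 ^ (i + ℓ) : ℕ) : ℤ)] * criticalCorr 3 2 ![Pi.single 1 ((2 ^ i : ℕ) : ℤ),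 Pi.single 0 (2 * ((2 ^ (i + ℓ) : ℕ) : ℤ)) + Pi.single 1 ((2 ^ (i + ℓ) : ℕ) : ℤ)])) ≤
        ((criticalCorr 3 4 ![0, Pi.single 1 1, Pi.single 0 (2 * ((2 ^ (i + ℓ) : ℕ) : ℤ)) + Pi.single 1 ((2 ^ (i + ℓ) : ℕ) : ℤ), Pi.single 0 (2 * ((2 ^ (i + ℓ) : ℕ) : ℤ)) - Pi.single 1 ((2 ^ (i + ℓ) : ℕ) : ℤ)] - criticalCorr 3 2 ![0, Pi.single 1 1] * criticalCorr 3 2 ![Pi.single 0 (2 * ((2 ^ (i + ℓ) : ℕ) : ℤ)) + Pi.single 1 ((2 ^ (i + ℓ) : ℕ) : ℤ), Pi.single 0 (2 * ((2 ^ (i + ℓ) : ℕ) : ℤ)) - Pi.single 1 ((2 ^ (i + ℓ) : ℕ) : ℤ)]) / (criticalCorr 3 2 ![0, Pi.single 0 (2 * ((2 ^ (i + ℓ) : ℕ) : ℤ)) - Pi.single 1 ((2 ^ (i + ℓ) : ℕ) : ℤ)] * criticalCorr 3 2 ![Pi.single 1 1, Pi.single 0 (2 * ((2 ^ (i + ℓ)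 : ℕ) : ℤ)) + Pi.single 1 ((2 ^ (i + ℓ) : ℕ) : ℤ)]))) →
      GapForcesFarMerging :=
  fun h => gapForcesFarMerging_of_quasiMultiplicativeDyadic (qmDyadicExplicit_iff.mp h)

/-- The explicit PT text IS `PinchedTransparencyShape cc2 (criticalCorr 3 4)`. [folklore] -/
theorem ptExplicit_iff :
    (∀ η : ℝ, 0 < η → η < 1 → ∃ ℓ₀ : ℕ, ∀ ℓ : ℕ, ℓ₀ ≤ ℓ → ∃ c : ℝ, η ^ ℓ ≤ c ∧ ∃ i₁ : ℕ, ∀ i : ℕ, i₁ ≤ i →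
      -(1 / 2 * (criticalCorr 3 2 ![0, Pi.single 0 (2 * ((2 ^ (i + ℓ) : ℕ) : ℤ)) - Pi.single 1 ((2 ^ (i + ℓ) : ℕ) : ℤ)] * criticalCorr 3 2 ![Pi.single 1 ((2 ^ i : ℕ) : ℤ), Pi.single 0 (2 * ((2 ^ (i + ℓ) : ℕ) : ℤ)) + Pi.single 1 ((2 ^ (i + ℓ) : ℕ) : ℤ)])) <
          criticalCorr 3 4 ![0, Pi.single 0 (2 * ((2 ^ (i + ℓ) : ℕ) : ℤ)) - Pi.single 1 ((2 ^ (i + ℓ) : ℕ) : ℤ), Pi.single 1 ((2 ^ i : ℕ) : ℤ), Pi.single 0 (2 * ((2 ^ (i + ℓ) : ℕ) : ℤ)) + Pi.single 1 ((2 ^ (i + ℓ) : ℕ) : ℤ)] -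
            (criticalCorr 3 2 ![0, Pi.single 0 (2 * ((2 ^ (i + ℓ) : ℕ) : ℤ)) - Pi.single 1 ((2 ^ (i + ℓ) : ℕ) : ℤ)] * criticalCorr 3 2 ![Pi.single 1 ((2 ^ i : ℕ) : ℤ), Pi.single 0 (2 * ((2 ^ (i + ℓ) : ℕ) : ℤ)) + Pi.single 1 ((2 ^ (i + ℓ) : ℕ) : ℤ)] +
              criticalCorr 3 2 ![0, Pi.single 1 ((2 ^ i : ℕ) : ℤ)] * criticalCorr 3 2 ![Pi.single 0 (2 * ((2 ^ (i + ℓ) : ℕ) : ℤ)) - Pi.single 1 ((2 ^ (i + ℓ) : ℕ) : ℤ), Pi.single 0 (2 * ((2 ^ (i + ℓ) : ℕ) : ℤ)) + Pi.single 1 ((2 ^ (i + ℓ) : ℕ) : ℤ)] +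
              criticalCorr 3 2 ![0, Pi.single 0 (2 * ((2 ^ (i + ℓ) : ℕ) : ℤ)) + Pi.single 1 ((2 ^ (i + ℓ) : ℕ) : ℤ)] * criticalCorr 3 2 ![Pi.single 0 (2 * ((2 ^ (i + ℓ) : ℕ) : ℤ)) - Pi.single 1 ((2 ^ (i + ℓ) : ℕ) : ℤ), Pi.single 1 ((2 ^ i : ℕ) : ℤ)]) →
        c * ((criticalCorr 3 4 ![0, Pi.single 1 1, Pi.single 0 (2 * ((2 ^ i : ℕ) : ℤ)) + Pi.single 1 ((2 ^ i : ℕ) : ℤ), Pi.single 0 (2 * ((2 ^ i : ℕ) : ℤ)) - Pi.single 1 ((2 ^ i : ℕ) : ℤ)] - criticalCorr 3 2 ![0, Pi.single 1 1] * criticalCorr 3 2 ![Pi.single 0 (2 * ((2 ^ i : ℕ) : ℤ)) + Pi.single 1 ((2 ^ i : ℕ) : ℤ), Pi.single 0 (2 * ((2 ^ i : ℕ) : ℤ)) - Pi.single 1 ((2 ^ i : ℕ) : ℤ)]) / (criticalCorr 3 2 ![0, Pi.single 0 (2 * ((2 ^ i : ℕ) : ℤ)) - Pi.single 1 ((2 ^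 i : ℕ) : ℤ)] * criticalCorr 3 2 ![Pi.single 1 1, Pi.single 0 (2 * ((2 ^ i : ℕ) : ℤ)) + Pi.single 1 ((2 ^ i : ℕ) : ℤ)])) ≤
          ((criticalCorr 3 4 ![0, Pi.single 1 1, Pi.single 0 (2 * ((2 ^ (i + ℓ) : ℕ) : ℤ)) + Pi.single 1 ((2 ^ (i + ℓ) : ℕ) : ℤ), Pi.single 0 (2 * ((2 ^ (i + ℓ) : ℕ) : ℤ)) - Pi.single 1 ((2 ^ (i + ℓ) : ℕ) : ℤ)] - criticalCorr 3 2 ![0, Pi.single 1 1] * criticalCorr 3 2 ![Pi.single 0 (2 * ((2 ^ (i + ℓ) : ℕ) : ℤ)) + Pi.single 1 ((2 ^ (i + ℓ) : ℕ) : ℤ), Pi.single 0 (2 * ((2 ^ (i + ℓ) : ℕ) : ℤ)) - Pi.single 1 ((2 ^ (i + ℓ) : ℕ) : ℤ)]) / (criticalCorr 3 2 ![0, Pi.single 0 (2 * ((2 ^ (i + ℓ) : ℕ) : ℤ)) - Pi.single 1 ((2 ^ (i + ℓ) : ℕ) : ℤ)] * criticalCorr 3 2 ![Pi.single 1 1,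 Pi.single 0 (2 * ((2 ^ (i + ℓ) : ℕ) : ℤ)) + Pi.single 1 ((2 ^ (i + ℓ) : ℕ) : ℤ)]))) ↔
      PinchedTransparencyShape cc2 (criticalCorr 3 4) :=
  Iff.rfl

/-- **Certificate (PT)**: pinched transparency, in item-ready explicit form, closes the crux BY NAME (landed
`gapForcesFarMerging_of_transparency`). [folklore] -/
theorem gapForcesFarMerging_of_ptExplicit :
    (∀ η : ℝ, 0 < η → η < 1 → ∃ ℓ₀ : ℕ, ∀ ℓ : ℕ, ℓ₀ ≤ ℓ → ∃ c : ℝ, η ^ ℓ ≤ c ∧ ∃ i₁ : ℕ, ∀ i : ℕ, i₁ ≤ i →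
      -(1 / 2 * (criticalCorr 3 2 ![0, Pi.single 0 (2 * ((2 ^ (i + ℓ) : ℕ) : ℤ)) - Pi.single 1 ((2 ^ (i + ℓ) : ℕ) : ℤ)] * criticalCorr 3 2 ![Pi.single 1 ((2 ^ i : ℕ) : ℤ), Pi.single 0 (2 * ((2 ^ (i + ℓ) : ℕ) : ℤ)) + Pi.single 1 ((2 ^ (i + ℓ) : ℕ) : ℤ)])) <
          criticalCorr 3 4 ![0, Pi.single 0 (2 * ((2 ^ (i + ℓ) : ℕ) : ℤ)) - Pi.single 1 ((2 ^ (i + ℓ) : ℕ) : ℤ), Pi.single 1 ((2 ^ i : ℕ) : ℤ), Pi.single 0 (2 * ((2 ^ (i + ℓ) : ℕ) : ℤ)) + Pi.single 1 ((2 ^ (i + ℓ) : ℕ) : ℤ)] -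
            (criticalCorr 3 2 ![0, Pi.single 0 (2 * ((2 ^ (i + ℓ) : ℕ) : ℤ)) - Pi.single 1 ((2 ^ (i + ℓ) : ℕ) : ℤ)] * criticalCorr 3 2 ![Pi.single 1 ((2 ^ i : ℕ) : ℤ), Pi.single 0 (2 * ((2 ^ (i + ℓ) : ℕ) : ℤ)) + Pi.single 1 ((2 ^ (i + ℓ) : ℕ) : ℤ)] +
              criticalCorr 3 2 ![0, Pi.single 1 ((2 ^ i : ℕ) : ℤ)] * criticalCorr 3 2 ![Pi.single 0 (2 * ((2 ^ (i + ℓ) : ℕ) : ℤ)) - Pi.single 1 ((2 ^ (i + ℓ) : ℕ) : ℤ), Pi.single 0 (2 * ((2 ^ (i + ℓ) : ℕ) : ℤ)) + Pi.single 1 ((2 ^ (i + ℓ) : ℕ) : ℤ)] +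
              criticalCorr 3 2 ![0, Pi.single 0 (2 * ((2 ^ (i + ℓ) : ℕ) : ℤ)) + Pi.single 1 ((2 ^ (i + ℓ) : ℕ) : ℤ)] * criticalCorr 3 2 ![Pi.single 0 (2 * ((2 ^ (i + ℓ) : ℕ) : ℤ)) - Pi.single 1 ((2 ^ (i + ℓ) : ℕ) : ℤ), Pi.single 1 ((2 ^ i : ℕ) : ℤ)]) →
        c * ((criticalCorr 3 4 ![0, Pi.single 1 1, Pi.single 0 (2 * ((2 ^ i : ℕ) : ℤ)) + Pi.single 1 ((2 ^ i : ℕ) : ℤ), Pi.single 0 (2 * ((2 ^ i : ℕ) : ℤ)) - Pi.single 1 ((2 ^ i : ℕ) : ℤ)] - criticalCorr 3 2 ![0, Pi.single 1 1] * criticalCorr 3 2 ![Pi.single 0 (2 * ((2 ^ i : ℕ) : ℤ)) + Pi.single 1 ((2 ^ i : ℕ) : ℤ), Pi.single 0 (2 * ((2 ^ i : ℕ) : ℤ)) - Pi.single 1 ((2 ^ i : ℕ) : ℤ)]) / (criticalCorr 3 2 ![0, Pi.single 0 (2 * ((2 ^ i : ℕ) : ℤ)) - Pi.single 1 ((2 ^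 i : ℕ) : ℤ)] * criticalCorr 3 2 ![Pi.single 1 1, Pi.single 0 (2 * ((2 ^ i : ℕ) : ℤ)) + Pi.single 1 ((2 ^ i : ℕ) : ℤ)])) ≤
          ((criticalCorr 3 4 ![0, Pi.single 1 1, Pi.single 0 (2 * ((2 ^ (i + ℓ) : ℕ) : ℤ)) + Pi.single 1 ((2 ^ (i + ℓ) : ℕ) : ℤ), Pi.single 0 (2 * ((2 ^ (i + ℓ) : ℕ) : ℤ)) - Pi.single 1 ((2 ^ (i + ℓ) : ℕ) : ℤ)] - criticalCorr 3 2 ![0, Pi.single 1 1] * criticalCorr 3 2 ![Pi.single 0 (2 * ((2 ^ (i + ℓ) : ℕ) : ℤ)) + Pi.single 1 ((2 ^ (i + ℓ) : ℕ) : ℤ), Pi.single 0 (2 * ((2 ^ (i + ℓ) : ℕ) : ℤ)) - Pi.single 1 ((2 ^ (i + ℓ) : ℕ) : ℤ)]) / (criticalCorr 3 2 ![0, Pi.single 0 (2 * ((2 ^ (i + ℓ) : ℕ) : ℤ)) - Pi.single 1 ((2 ^ (i + ℓ) : ℕ) : ℤ)] * criticalCorr 3 2 ![Pi.single 1 1,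 Pi.single 0 (2 * ((2 ^ (i + ℓ) : ℕ) : ℤ)) + Pi.single 1 ((2 ^ (i + ℓ) : ℕ) : ℤ)]))) →
      GapForcesFarMerging :=
  fun h => gapForcesFarMerging_of_transparency (ptExplicit_iff.mp h)

/-- Ladder, first arrow: QM (explicit) ⇒ dyadic QM (landed `qmDyadic_of_qm`). [folklore] -/
theorem qmDyadic_of_qmExplicit :
    (∃ c : ℝ, 0 < c ∧ ∀ s m : ℕ, 1 ≤ s → 2 * s ≤ m →
      c * ((criticalCorr 3 4 ![0, Pi.single 1 1, Pi.single 0 (2 * (s : ℤ)) + Pi.single 1 (s : ℤ), Pi.single 0 (2 * (s : ℤ)) - Pi.single 1 (s : ℤ)] - criticalCorr 3 2 ![0, Pi.single 1 1] * criticalCorr 3 2 ![Pi.single 0 (2 * (s : ℤ)) + Pi.single 1 (s : ℤ), Pi.single 0 (2 * (s : ℤ)) - Pi.single 1 (s : ℤ)]) / (criticalCorr 3 2 ![0, Pi.single 0 (2 * (s : ℤ)) - Pi.single 1 (s : ℤ)] * criticalCorr 3 2 ![Pi.single 1 1, Pi.single 0 (2 * (s : ℤ)) + Pi.single 1 (s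 : ℤ)])) *
          ((criticalCorr 3 4 ![0, Pi.single 1 (s : ℤ), Pi.single 0 (2 * (m : ℤ)) + Pi.single 1 (m : ℤ), Pi.single 0 (2 * (m : ℤ)) - Pi.single 1 (m : ℤ)] - criticalCorr 3 2 ![0, Pi.single 1 (s : ℤ)] * criticalCorr 3 2 ![Pi.single 0 (2 * (m : ℤ)) + Pi.single 1 (m : ℤ), Pi.single 0 (2 * (m : ℤ)) - Pi.single 1 (m : ℤ)]) / (criticalCorr 3 2 ![0, Pi.single 0 (2 * (m : ℤ)) - Pi.single 1 (m : ℤ)] * criticalCorr 3 2 ![Pi.single 1 (s : ℤ), Pi.single 0 (2 * (m : ℤ)) + Pi.single 1 (m : ℤ)])) ≤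
        ((criticalCorr 3 4 ![0, Pi.single 1 1, Pi.single 0 (2 * (m : ℤ)) + Pi.single 1 (m : ℤ), Pi.single 0 (2 * (m : ℤ)) - Pi.single 1 (m : ℤ)] - criticalCorr 3 2 ![0, Pi.single 1 1] * criticalCorr 3 2 ![Pi.single 0 (2 * (m : ℤ)) + Pi.single 1 (m : ℤ), Pi.single 0 (2 * (m : ℤ)) - Pi.single 1 (m : ℤ)]) / (criticalCorr 3 2 ![0, Pi.single 0 (2 * (m : ℤ)) - Pi.single 1 (m : ℤ)] * criticalCorr 3 2 ![Pi.single 1 1, Pi.single 0 (2 * (m : ℤ)) + Pi.single 1 (m : ℤ)]))) →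
      QuasiMultiplicativeDyadicShape cc2 (criticalCorr 3 4) :=
  fun h => qmDyadic_of_qm (qmExplicit_iff.mp h)

/-- Ladder, second arrow: dyadic QM (explicit) ⇒ pinched transparency (landed `transparency_of_qmDyadic` over the Ising
certificate `softPackageNoBubble_criticalCorr`). [folklore] -/
theorem pinchedTransparency_of_qmDyadicExplicit :
    (∀ η : ℝ, 0 < η → η < 1 → ∃ ℓ₀ : ℕ, ∀ ℓ : ℕ, ℓ₀ ≤ ℓ → ∃ c : ℝ, η ^ ℓ ≤ c ∧ ∃ i₁ : ℕ, ∀ i : ℕ, i₁ ≤ i →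
      c * ((criticalCorr 3 4 ![0, Pi.single 1 1, Pi.single 0 (2 * ((2 ^ i : ℕ) : ℤ)) + Pi.single 1 ((2 ^ i : ℕ) : ℤ), Pi.single 0 (2 * ((2 ^ i : ℕ) : ℤ)) - Pi.single 1 ((2 ^ i : ℕ) : ℤ)] - criticalCorr 3 2 ![0, Pi.single 1 1] * criticalCorr 3 2 ![Pi.single 0 (2 * ((2 ^ i : ℕ) : ℤ)) + Pi.single 1 ((2 ^ i : ℕ) : ℤ), Pi.single 0 (2 * ((2 ^ i : ℕ) : ℤ)) - Pi.single 1 ((2 ^ i : ℕ) : ℤ)]) / (criticalCorr 3 2 ![0, Pi.single 0 (2 * ((2 ^ i : ℕ) : ℤ)) - Pi.single 1 ((2 ^ i : ℕ) : ℤ)] * criticalCorr 3 2 ![Pi.single 1 1, Pi.single 0 (2 * ((2 ^ i : ℕ) : ℤ)) + Pi.single 1 ((2 ^ i : ℕ) : ℤ)])) *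
          ((criticalCorr 3 4 ![0, Pi.single 1 ((2 ^ i : ℕ) : ℤ), Pi.single 0 (2 * ((2 ^ (i + ℓ) : ℕ) : ℤ)) + Pi.single 1 ((2 ^ (i + ℓ) : ℕ) : ℤ), Pi.single 0 (2 * ((2 ^ (i + ℓ) : ℕ) : ℤ)) - Pi.single 1 ((2 ^ (i + ℓ) : ℕ) : ℤ)] - criticalCorr 3 2 ![0, Pi.single 1 ((2 ^ i : ℕ) : ℤ)] * criticalCorr 3 2 ![Pi.single 0 (2 * ((2 ^ (i + ℓ) : ℕ) : ℤ)) + Pi.single 1 ((2 ^ (i + ℓ) : ℕ) : ℤ), Pi.single 0 (2 * ((2 ^ (i + ℓ) : ℕ) : ℤ)) - Pi.single 1 ((2 ^ (i + ℓ) : ℕ) : ℤ)]) / (criticalCorr 3 2 ![0, Pi.single 0 (2 * ((2 ^ (i + ℓ) : ℕ) : ℤ)) - Pi.single 1 ((2 ^ (i + ℓ) : ℕ) : ℤ)] * criticalCorr 3 2 ![Pi.single 1 ((2 ^ i : ℕ) : ℤ), Pi.single 0 (2 * ((2 ^ (i + ℓ) : ℕ) : ℤ)) + Pi.single 1 ((2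 ^ (i + ℓ) : ℕ) : ℤ)])) ≤
        ((criticalCorr 3 4 ![0, Pi.single 1 1, Pi.single 0 (2 * ((2 ^ (i + ℓ) : ℕ) : ℤ)) + Pi.single 1 ((2 ^ (i + ℓ) : ℕ) : ℤ), Pi.single 0 (2 * ((2 ^ (i + ℓ) : ℕ) : ℤ)) - Pi.single 1 ((2 ^ (i + ℓ) : ℕ) : ℤ)] - criticalCorr 3 2 ![0, Pi.single 1 1] * criticalCorr 3 2 ![Pi.single 0 (2 * ((2 ^ (i + ℓ) : ℕ) : ℤ)) + Pi.single 1 ((2 ^ (i + ℓ) : ℕ) : ℤ), Pi.single 0 (2 * ((2 ^ (i + ℓ) : ℕ) : ℤ)) - Pi.single 1 ((2 ^ (i + ℓ) : ℕ) : ℤ)]) / (criticalCorr 3 2 ![0, Pi.single 0 (2 * ((2 ^ (i + ℓ) : ℕ) : ℤ)) - Pi.single 1 ((2 ^ (i + ℓ) : ℕ) : ℤ)] * criticalCorr 3 2 ![Pi.single 1 1, Pi.single 0 (2 * ((2 ^ (i + ℓ) : ℕ) : ℤ)) + Pi.single 1 ((2 ^ (i + ℓ) : ℕ) : ℤ)])))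 →
      PinchedTransparencyShape cc2 (criticalCorr 3 4) :=
  fun h => transparency_of_qmDyadic softPackageNoBubble_criticalCorr (qmDyadicExplicit_iff.mp h)

/-- **The promotion ladder** over the shape names: QM ⇒ QM-dyadic ⇒ PT ⇒ crux, each arrow a landed theorem; with the three
`…Explicit_iff` lemmas above every rung has an item-ready explicit text. [folklore] -/
theorem promotion_ladder :
    (QuasiMultiplicativeShape cc2 (criticalCorr 3 4) → QuasiMultiplicativeDyadicShape cc2 (criticalCorr 3 4)) ∧
    (QuasiMultiplicativeDyadicShape cc2 (criticalCorr 3 4) → PinchedTransparencyShape cc2 (criticalCorr 3 4)) ∧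
    (PinchedTransparencyShape cc2 (criticalCorr 3 4) → GapForcesFarMerging) :=
  ⟨qmDyadic_of_qm, transparency_of_qmDyadic softPackageNoBubble_criticalCorr, gapForcesFarMerging_of_transparency⟩

end Summit.CriticalPhenomena.Ising3DConformalLimit.EnergyNotSigmaSquaredGapForcesFarMerging.Promotion

end
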